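import Literature.NumberTheory.Rogawski1990.ArchCentralLimitNoncompactWallFirstJetCM    -- ★ p843187: `angleChart_wall02_apply_zero_{eq_two,ne_one}`; brings the (J-nc) letter's imports and ★ `rhoWeylDelta_angleChart_wall02_line`
import Literature.NumberTheory.Rogawski1990.ArchLimitFormulaNoncompactWallProof        -- ★ p840819 (p06): the (J-nc) descent whose set-up this file replays ((d1)(d3a)(d3a-II), Bruhat cut-off)
import Literature.NumberTheory.Automorphic.ArchLocalWallCentralizerHaar                -- ★ `exists_isHaarMeasure_isInvInvariant_centralizer_circleDiagonal_wall`
import Literature.NumberTheory.Automorphic.ArchLocalWallAveragedTestFunctionSmooth       -- ★ p843990 (p05): `contDiff_three_averagedTestFunction` (`f♭ ∈ C³`)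
import Literature.NumberTheory.Automorphic.ArchRankOneThirdJetEvenFactor               -- ★ Z5 (a): `exists_tendsto_iteratedDeriv_three_evenFactor_mul`; brings ★ Z4 `exists_jets_orbitalIntegral`
import Literature.NumberTheory.Rogawski1990.ArchCentralDescentAssemblyKit              -- ★ `isMulRightInvariant_of_isHaarMeasure_archLocal_diagonal` (Haar on `U(e₀,e₂)` is right-invariant)
import HarnessLib

/-!
# (J3-odd)₃ PROVED FOR THE LETTER'S `F_Θ` (CM ground field): the third normal derivative of `F_Θ = ρ′Δ·Φ_Θ` along the normal line through a semiregular point of the noncompact wall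
# `θ₀ = θ₂` has ONE two-sided limit — [Varadarajan1989 §6.4 Thm 24, `r = 1`] descended to `U(2,1)` (Rogawski 1990 §8.4 p. 126, §8.2 pp. 119–123)

Topic `NumberTheory/Rogawski1990`; namespace `Literature.NumberTheory.Rogawski1990`.  ONE THEOREM (no `def`, no instance, no notation, no axiom, no named fact, no `sorry`).
Cell `pub/hodgecm-mathlib`, ENGINE T1 (crux H413 = `stmt-HodgeConjecture-24833`); ROAD A toward N1 = the registered stub `stub_L21` (closer) ∕ `stub_ArchCentralLimitU21` («SdArch»); ROAD A owner
F0P3a-p05 (g14) WORD R-14.4 «N1 closes by ONE term modulo {(A6), hD = W6, hS = Z5}»; this is **Z5 (b) = `hS`**, the LAST file of A-p18's road (Z) (census 7db511ac, g25; Z1 ★ p843784, Z2 ★ p843797,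
Z3 ★ p843983∕p844004, Z4 ★ p844064, Z5 (a) `ArchRankOneThirdJetEvenFactor`, «Z5-pre» ★ p843990 (p05)).  Author A-p18 (g26), 2026-09-01.

**`wall02_cubeLimit`** = the hypothesis `hS` of ★ `ArchCentralLimitFormulaRankTwo.of_cornerRegularity_of_wallValues` (F0P3a-p02, p844011) VERBATIM, under that theorem's own sign hypothesis
`re σ_wα₀ · re σ_wα₂ < 0` (the pair `{0,2}` is NONCOMPACT): for a CM field `L`, `α_i ≠ 0` with `σ_w α_i` real, every right-invariant Haar `ν` on `G_w = U(σ_w diag α)(ℂ)`, every smooth `Θ`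
compactly supported on `G_w`, every `ζ ∈ S¹` and wall parameter `t` with `cos 3t ≠ 1` (the wall point `ζe^{itA′} = (ζe^{it}, ζe^{−2it}, ζe^{it})` is SEMIREGULAR):
`∃ Lim, (d∕ds)³ [ρ′Δ(ζe^{i(tA′+sN′)}) · ∫_{G_w} Θ(g·t_w(ζe^{i(tA′+sN′)})·g⁻¹) dν] → Lim` as `s → 0`, `s ≠ 0` (`A′ = (1,−2,1)`, `N′ = (1,0,−1)`).

PROOF (the (J-nc) descent of ★ `archLimitFormulaNoncompactWall_holds` replayed up to its identity, then road (Z)).  WLOG `Θ` has ambient compact support (★ p840156).  With the wall point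
`z₀ = ζe^{itA′}`, `H_w = Z(t_w z₀) ≅ G₂ × G₁` (★ (V9)), its inversion-invariant Haar measure `νH` (★ `ArchLocalWallCentralizerHaar`), Haar measures on the blocks, ★ (d3a) gives ONE `c₀ > 0`;
★ (d1) + the local Bruhat cut-off `β` (★ p840607) over the compact set of torus points `z₀·e^{isN′}`, `|s| ≤ δ`, give the averaged test function `f♭ ∈ C³_c(M₂(ℂ))` (★ p843990 +
★ `hasCompactSupport_averagedTestFunction`) with **`2 sin s · Φ_Θ(z_s) = c₀ · F_{f♭}(s)`** for `0 < |s| < δ`, `F_{f♭}(s) = 2 sin s · ∫_{G₂} f♭(h·diag(z₀(0)e^{is}, z₀(0)e^{−is})·h⁻¹) dμ₂` the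
normalised rank-one orbital integral of ★ (R1G)∕★ Z4 on `G₂ = U(σ_wα₀, σ_wα₂)(ℂ) ≅ U(1,1)`.  Along the normal line `ρ′Δ = 2 sin s · i(2cos s − 2cos 3t)` (★ `rhoWeylDelta_angleChart_wall02_line`), so
`F_Θ(s) = m(s) · F_{f♭}(s)` on `0 < |s| < δ` with `m(s) = c₀·i(2cos s − 2cos 3t)`.  ★ Z4 `exists_jets_orbitalIntegral` (Haar on `G₂` is right-invariant: ★ `isMulRightInvariant_of_isHaarMeasure_archLocal_diagonal`)
supplies the jets of `F_{f♭}`, ★ Z5 (a) `exists_tendsto_iteratedDeriv_three_evenFactor_mul` the two-sided limit of `(m·F_{f♭})‴`, and `iteratedDeriv 3` is local (`Filter.EventuallyEq.iteratedDeriv_eq`).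
HONEST LABEL: this discharges the print row (J3-odd)₃ for `F_Θ` at CM frames; N1 still needs the (A6) row and W6's `hD`; HC_CM is proved only modulo the printed citations until rung 0 closes.

## References
* [Varadarajan1989] V. S. Varadarajan, *An Introduction to Harmonic Analysis on Semisimple Lie Groups* (1989), §6.4 Thm 24 (odd derivatives of `F_f` continuous at `0`), Thm 22, Lemma 21.
* [Rogawski1990] J. D. Rogawski, *Automorphic Representations of Unitary Groups in Three Variables*, Ann. of Math. Stud. 123 (1990), §8.4 pp. 126–127, §8.2 pp. 119–123.
* [Folland1995] G. B. Folland, *A Course in Abstract Harmonic Analysis* (1995), §2.6 (Weil's formula, Bruhat cut-offs).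
-/

set_option autoImplicit false

noncomputable section

open Filter Topology Set Complex MeasureTheory Measure NumberField NumberField.InfinitePlace
open Literature.NumberTheory.Automorphic Literature.NumberTheory.Automorphic.UnitaryGroup Literature.NumberTheory.Automorphic.RankOneCasimir
open Literature.MeasureTheory.Group Literature.Analysis.Calculus
open scoped Matrix MatrixGroups Matrix.Norms.Operator Pointwise

namespace Literature.NumberTheory.Rogawski1990

section CubeLimit

variable (L : Type) [Field L] [NumberField L] [IsCMField L] (α : Fin 3 → L) (w : {w : InfinitePlace L // IsComplex w})

/-- **(J3-odd)₃ FOR `F_Θ` — the `hS` input of ★ `ArchCentralLimitFormulaRankTwo.of_cornerRegularity_of_wallValues`, PROVED** (CM ground field, the pair `{0,2}` noncompact): at every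
semiregular point `ζe^{itA′}` (`cos 3t ≠ 1`) of the noncompact wall `θ₀ = θ₂` the third `s`-derivative of `s ↦ ρ′Δ(ζe^{i(tA′+sN′)})·∫_{G_w} Θ(g·t_w(ζe^{i(tA′+sN′)})·g⁻¹) dν` has ONE
two-sided limit as `s → 0`, `s ≠ 0`.  Road (Z): (J-nc) descent to the block group `U(e₀,e₂)` + [Varadarajan1989 §6.4 Thm 24] there (★ Z4) + Leibniz with the even cofactor of `ρ′Δ`
(★ Z5 (a)); see the module docstring. [cite: Varadarajan1989, §6.4 Thm 24] [cite: Rogawski1990, §8.4 pp. 126–127] [cite: Rogawski1990, §8.2 p. 119] -/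
theorem wall02_cubeLimit (hsgn : (w.1.embedding (α 0)).re * (w.1.embedding (α 2)).re < 0) :
    ∀ [MeasurableSpace (archLocal L 3 (Matrix.diagonal α) w)] [BorelSpace (archLocal L 3 (Matrix.diagonal α) w)],
      (∀ i, α i ≠ 0) → (∀ i, (w.1.embedding (α i)).im = 0) →
      ∀ (ν : Measure (archLocal L 3 (Matrix.diagonal α) w)) [ν.IsHaarMeasure] [ν.IsMulRightInvariant]
        (Θ : Matrix (Fin 3) (Fin 3) ℂ → ℂ), ContDiff ℝ (⊤ : ℕ∞) Θ →
          HasCompactSupport (fun k : archLocal L 3 (Matrix.diagonal α) w => Θ ((k : GL (Fin 3) ℂ) : Matrix (Fin 3) (Fin 3) ℂ)) →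
          ∀ (ζ : Circle) (t : ℝ), Real.cos (3 * t) ≠ 1 →
            ∃ Lim : ℂ, Tendsto (fun ψ : ℝ => iteratedDeriv 3 (fun s : ℝ =>
              ((((ζ * Circle.exp ((t • (![1, -2, 1] : Fin 3 → ℝ) + s • (![1, 0, -1] : Fin 3 → ℝ)) 0) : Circle) : ℂ)) * (((ζ * Circle.exp ((t • (![1, -2, 1] : Fin 3 → ℝ) + s • (![1, 0, -1] : Fin 3 → ℝ)) 2) : Circle) : ℂ))⁻¹) * ((1 - (((ζ * Circle.exp ((t • (![1, -2, 1] : Fin 3 → ℝ) + s • (![1, 0, -1] : Fin 3 → ℝ)) 1) : Circle) : ℂ)) * (((ζ * Circle.exp ((t • (![1, -2, 1] : Fin 3 → ℝ) + s • (![1, 0, -1] : Fin 3 → ℝ)) 0) : Circle) : ℂ))⁻¹) * (1 - (((ζ * Circle.exp ((t • (![1, -2, 1] : Fin 3 → ℝ) + s • (![1, 0, -1] : Fin 3 → ℝ)) 2) : Circle) : ℂ)) * (((ζ * Circle.exp ((t • (![1, -2, 1] : Fin 3 → ℝ) + s • (![1, 0, -1] : Fin 3 → ℝ)) 1) : Circle)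 : ℂ))⁻¹) * (1 - (((ζ * Circle.exp ((t • (![1, -2, 1] : Fin 3 → ℝ) + s • (![1, 0, -1] : Fin 3 → ℝ)) 2) : Circle) : ℂ)) * (((ζ * Circle.exp ((t • (![1, -2, 1] : Fin 3 → ℝ) + s • (![1, 0, -1] : Fin 3 → ℝ)) 0) : Circle) : ℂ))⁻¹)) * (∫ g, Θ (((g * ⟨circleDiagonal 3 (fun k => ζ * Circle.exp ((t • (![1, -2, 1] : Fin 3 → ℝ) + s • (![1, 0, -1] : Fin 3 → ℝ)) k)), circleDiagonal_mem_archLocal_diagonal L 3 α w _⟩ * g⁻¹ : archLocal L 3 (Matrix.diagonal α) w) : GL (Fin 3) ℂ) : Matrix (Fin 3) (Fin 3) ℂ) ∂ν)) ψ) (𝓝[≠] 0) (𝓝 Lim) := by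
  intro _ _ hα hreal ν _ _ Θ hΘ hΘs ζ t ht
  classical
  haveI : LocallyCompactSpace (archLocal L 3 (Matrix.diagonal α) w) := locallyCompactSpace_archLocal L 3 (Matrix.diagonal α) w
  haveI : SecondCountableTopology (archLocal L 3 (Matrix.diagonal α) w) := secondCountableTopology_archLocal L 3 (Matrix.diagonal α) w
  -- topology, Borel structures and Haar measures on the block groups `G₂`, `G₁` (both spellings of `G₂`)
  haveI : LocallyCompactSpace (unitaryGroupOfForm (starRingEnd ℂ) ((Matrix.diagonal ![α 0, α 2]).map w.1.embedding)) := locallyCompactSpace_archLocal L 2 (Matrix.diagonal ![α 0, α 2]) w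
  haveI : SecondCountableTopology (unitaryGroupOfForm (starRingEnd ℂ) ((Matrix.diagonal ![α 0, α 2]).map w.1.embedding)) := secondCountableTopology_archLocal L 2 (Matrix.diagonal ![α 0, α 2]) w
  haveI : LocallyCompactSpace (unitaryGroupOfForm (starRingEnd ℂ) ((Matrix.diagonal ![α 1]).map w.1.embedding)) := locallyCompactSpace_archLocal L 1 (Matrix.diagonal ![α 1]) w
  haveI : SecondCountableTopology (unitaryGroupOfForm (starRingEnd ℂ) ((Matrix.diagonal ![α 1]).map w.1.embedding)) := secondCountableTopology_archLocal L 1 (Matrix.diagonal ![α 1]) w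
  letI iM2 : MeasurableSpace (unitaryGroupOfForm (starRingEnd ℂ) ((Matrix.diagonal ![α 0, α 2]).map w.1.embedding)) := borel _
  haveI iB2 : BorelSpace (unitaryGroupOfForm (starRingEnd ℂ) ((Matrix.diagonal ![α 0, α 2]).map w.1.embedding)) := ⟨rfl⟩
  letI : MeasurableSpace (unitaryGroupOfForm (starRingEnd ℂ) ((Matrix.diagonal ![α 1]).map w.1.embedding)) := borel _
  haveI : BorelSpace (unitaryGroupOfForm (starRingEnd ℂ) ((Matrix.diagonal ![α 1]).map w.1.embedding)) := ⟨rfl⟩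
  letI : MeasurableSpace (archLocal L 2 (Matrix.diagonal ![α 0, α 2]) w) := iM2
  haveI : BorelSpace (archLocal L 2 (Matrix.diagonal ![α 0, α 2]) w) := iB2
  -- hermitian-diagonal from the reality hypothesis
  have hherm : ∀ i, (IsCMField.complexConj L (α i) : L) = α i := fun i => by
    apply w.1.embedding.injective
    rw [NumberField.IsCMField.complexEmbedding_complexConj, Complex.conj_eq_iff_im, hreal i]
  -- the wall point `z₀ = ζe^{itA′}`: `z₀ 0 = z₀ 2 ≠ z₀ 1`
  obtain ⟨z₀, hz₀def⟩ : ∃ z₀ : Fin 3 → Circle, z₀ = fun k : Fin 3 => ζ * Circle.exp ((t • (![1, -2, 1] : Fin 3 → ℝ)) k) := ⟨_, rfl⟩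
  have h02 : z₀ 0 = z₀ 2 := by rw [hz₀def]; exact angleChart_wall02_apply_zero_eq_two ζ t
  have h01 : z₀ 0 ≠ z₀ 1 := by rw [hz₀def]; exact angleChart_wall02_apply_zero_ne_one ζ ht
  have hZ : IsClosed ((Subgroup.centralizer ({(⟨circleDiagonal 3 z₀, circleDiagonal_mem_archLocal_diagonal L 3 α w z₀⟩ : archLocal L 3 (Matrix.diagonal α) w)} : Set (archLocal L 3 (Matrix.diagonal α) w))) : Set (archLocal L 3 (Matrix.diagonal α) w)) := isClosed_coe_centralizer_singleton _
  -- `νH` (★ `ArchLocalWallCentralizerHaar`) and `H_w ≃ₜ* G₂ × G₁` (★ (V9))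
  obtain ⟨νH, hνH, -, hνHinv⟩ := exists_isHaarMeasure_isInvInvariant_centralizer_circleDiagonal_wall L α w hα hreal h02 h01
  haveI := hνH
  haveI := hνHinv
  obtain ⟨e, he⟩ := exists_centralizer_continuousMulEquiv_of_splitSingular L α w h02 h01
  -- ★ (d3a): the regular-side constant `c₀`
  obtain ⟨c₀, hc₀, hB⟩ := exists_integral_comp_conj_circleDiagonal_eq_mul_integral_averaged L α w hα hreal e he νH
    (haar : Measure (unitaryGroupOfForm (starRingEnd ℂ) ((Matrix.diagonal ![α 0, α 2]).map w.1.embedding))) (haar : Measure (unitaryGroupOfForm (starRingEnd ℂ) ((Matrix.diagonal ![α 1]).map w.1.embedding))) ν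
  have hreal2 : ∀ i, (w.1.embedding ((![α 0, α 2] : Fin 2 → L) i)).im = 0 := fun i => by
    fin_cases i
    · exact hreal 0
    · exact hreal 2
  have hsgn2 : (w.1.embedding ((![α 0, α 2] : Fin 2 → L) 0)).re * (w.1.embedding ((![α 0, α 2] : Fin 2 → L) 1)).re < 0 := by simpa using hsgn
  have hα2 : ∀ i, (![α 0, α 2] : Fin 2 → L) i ≠ 0 := fun i => by
    fin_cases i
    · exact hα 0
    · exact hα 2
  have hherm2 : ∀ i, (IsCMField.complexConj L ((![α 0, α 2] : Fin 2 → L) i) : L) = (![α 0, α 2] : Fin 2 → L) i := fun i => by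
    fin_cases i
    · exact hherm 0
    · exact hherm 2
  -- Haar on `G₂` is right-invariant (unimodular), in both spellings
  haveI : @Measure.IsHaarMeasure (archLocal L 2 (Matrix.diagonal ![α 0, α 2]) w) _ _ iM2 (haar : Measure (unitaryGroupOfForm (starRingEnd ℂ) ((Matrix.diagonal ![α 0, α 2]).map w.1.embedding))) :=
    (inferInstance : (haar : Measure (unitaryGroupOfForm (starRingEnd ℂ) ((Matrix.diagonal ![α 0, α 2]).map w.1.embedding))).IsHaarMeasure)
  have hri := isMulRightInvariant_of_isHaarMeasure_archLocal_diagonal L ![α 0, α 2] hα2 hherm2 w (haar : Measure (unitaryGroupOfForm (starRingEnd ℂ) ((Matrix.diagonal ![α 0, α 2]).map w.1.embedding)))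
  haveI : (haar : Measure (unitaryGroupOfForm (starRingEnd ℂ) ((Matrix.diagonal ![α 0, α 2]).map w.1.embedding))).IsMulRightInvariant := hri
  -- WLOG `Θ` has AMBIENT compact support (★ p840156): the statement only reads `Θ ∘ ↑↑`
  have hcoe : Continuous fun k : archLocal L 3 (Matrix.diagonal α) w => ((k : GL (Fin 3) ℂ) : Matrix (Fin 3) (Fin 3) ℂ) := Units.continuous_val.comp continuous_subtype_val
  obtain ⟨Θ', hΘ', hΘ's, -, hagree⟩ := exists_contDiff_hasCompactSupport_comp_eq (ι := fun k : archLocal L 3 (Matrix.diagonal α) w => ((k : GL (Fin 3) ℂ) : Matrix (Fin 3) (Fin 3) ℂ)) hcoe hΘ hΘs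
  have hagree' : ∀ k : archLocal L 3 (Matrix.diagonal α) w, Θ ((k : GL (Fin 3) ℂ) : Matrix (Fin 3) (Fin 3) ℂ) = Θ' ((k : GL (Fin 3) ℂ) : Matrix (Fin 3) (Fin 3) ℂ) := fun k => (hagree k).symm
  simp_rw [hagree']
  have hΘ'c : Continuous Θ' := hΘ'.continuous
  have hΘ'k : HasCompactSupport fun k : archLocal L 3 (Matrix.diagonal α) w => Θ' ((k : GL (Fin 3) ℂ) : Matrix (Fin 3) (Fin 3) ℂ) := by
    have h : (fun k : archLocal L 3 (Matrix.diagonal α) w => Θ' ((k : GL (Fin 3) ℂ) : Matrix (Fin 3) (Fin 3) ℂ)) = fun k : archLocal L 3 (Matrix.diagonal α) w => Θ ((k : GL (Fin 3) ℂ) : Matrix (Fin 3) (Fin 3) ℂ) := funext fun k => (hagree' k).symm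
    rw [h]; exact hΘs
  -- the normal line through `z₀` IS the (J-nc) curve `s ↦ z₀·e^{isN′}`
  have hcur : ∀ s : ℝ, (fun k : Fin 3 => ζ * Circle.exp ((t • (![1, -2, 1] : Fin 3 → ℝ) + s • (![1, 0, -1] : Fin 3 → ℝ)) k)) = fun i : Fin 3 => z₀ i * Circle.exp ((![1, 0, -1] : Fin 3 → ℝ) i * s) := fun s => by
    funext k
    rw [hz₀def]
    simp only [Pi.add_apply, Pi.smul_apply, smul_eq_mul, Circle.exp_add, mul_assoc, mul_comm s]
  -- a `δ₁` with `z₀ 0 · e^{iψ} ≠ z₀ 1` for `|ψ| < δ₁`, and `δ = min (δ₁∕2) (1∕2)`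
  have hne0 : (fun ψ : ℝ => z₀ 0 * Circle.exp ψ) 0 ≠ z₀ 1 := by simpa [Circle.exp_zero] using h01
  obtain ⟨δ₁, hδ₁, hδ₁ne⟩ : ∃ δ₁ > 0, ∀ ψ : ℝ, |ψ| < δ₁ → z₀ 0 * Circle.exp ψ ≠ z₀ 1 := by
    have hopen : IsOpen {ψ : ℝ | z₀ 0 * Circle.exp ψ ≠ z₀ 1} :=
      isOpen_ne_fun (continuous_const.mul Circle.exp.continuous) continuous_const
    obtain ⟨δ₁, hδ₁, hball⟩ := Metric.isOpen_iff.mp hopen 0 hne0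
    exact ⟨δ₁, hδ₁, fun ψ hψ => hball (by simpa [Real.dist_eq] using hψ)⟩
  obtain ⟨δ, hδdef⟩ : ∃ δ : ℝ, δ = min (δ₁ / 2) (1 / 2) := ⟨_, rfl⟩
  have hδ : 0 < δ := by rw [hδdef]; exact lt_min (by linarith) (by norm_num)
  have hδ₁' : ∀ ψ : ℝ, |ψ| ≤ δ → |ψ| < δ₁ := fun ψ hψ => by
    have : δ ≤ δ₁ / 2 := by rw [hδdef]; exact min_le_left _ _
    linarith
  have hδ1 : ∀ ψ : ℝ, |ψ| < δ → |ψ| < 1 := fun ψ hψ => by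
    have : δ ≤ 1 / 2 := by rw [hδdef]; exact min_le_right _ _
    linarith
  have hz0 : ∀ ψ : ℝ, (fun i => z₀ i * Circle.exp ((![1, 0, -1] : Fin 3 → ℝ) i * ψ)) 0 = z₀ 0 * Circle.exp ψ := fun ψ => by simp
  have hz1 : ∀ ψ : ℝ, (fun i => z₀ i * Circle.exp ((![1, 0, -1] : Fin 3 → ℝ) i * ψ)) 1 = z₀ 1 := fun ψ => by simp [Circle.exp_zero]
  have hz2 : ∀ ψ : ℝ, (fun i => z₀ i * Circle.exp ((![1, 0, -1] : Fin 3 → ℝ) i * ψ)) 2 = z₀ 0 * Circle.exp (-ψ) := fun ψ => by simp [h02]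
  have hsep : ∀ ψ : ℝ, |ψ| < δ₁ → (fun i => z₀ i * Circle.exp ((![1, 0, -1] : Fin 3 → ℝ) i * ψ)) 1 ≠ (fun i => z₀ i * Circle.exp ((![1, 0, -1] : Fin 3 → ℝ) i * ψ)) 0 ∧ (fun i => z₀ i * Circle.exp ((![1, 0, -1] : Fin 3 → ℝ) i * ψ)) 1 ≠ (fun i => z₀ i * Circle.exp ((![1, 0, -1] : Fin 3 → ℝ) i * ψ)) 2 := fun ψ hψ => by
    refine ⟨?_, ?_⟩
    · rw [hz1, hz0]; exact (hδ₁ne ψ hψ).symm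
    · rw [hz1, hz2]; exact (hδ₁ne (-ψ) (by simpa using hψ)).symm
  have hreg : ∀ ψ : ℝ, ψ ≠ 0 → |ψ| < δ → ∀ i j : Fin 3, i ≠ j → (fun i => z₀ i * Circle.exp ((![1, 0, -1] : Fin 3 → ℝ) i * ψ)) i ≠ (fun i => z₀ i * Circle.exp ((![1, 0, -1] : Fin 3 → ℝ) i * ψ)) j := by
    intro ψ hψ0 hψ
    have h01ψ := (hsep ψ ((hδ₁' ψ hψ.le))).1
    have h12ψ := (hsep ψ ((hδ₁' ψ hψ.le))).2
    have h02ψ : (fun i => z₀ i * Circle.exp ((![1, 0, -1] : Fin 3 → ℝ) i * ψ)) 0 ≠ (fun i => z₀ i * Circle.exp ((![1, 0, -1] : Fin 3 → ℝ) i * ψ)) 2 := by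
      rw [hz0, hz2]
      intro h
      have h' : Circle.exp ψ = Circle.exp (-ψ) := mul_left_cancel h
      obtain ⟨m, hm⟩ := Circle.exp_eq_exp.mp h'
      have hψ1 : |ψ| < 1 := hδ1 ψ hψ
      have hm0 : (m : ℝ) = 0 ∨ (1 : ℝ) ≤ |(m : ℝ)| := by
        rcases eq_or_ne m 0 with h0 | h0
        · left; simp [h0]
        · right; exact_mod_cast Int.one_le_abs h0
      rcases hm0 with hm0 | hm1
      · rw [hm0, zero_mul, add_zero] at hm; exact hψ0 (by linarith)
      · have : (2 : ℝ) * ψ = m * (2 * Real.pi) := by linarith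
        have h2 : |(2 : ℝ) * ψ| = |(m : ℝ)| * (2 * Real.pi) := by
          rw [this, abs_mul, abs_of_pos (by positivity : (0 : ℝ) < 2 * Real.pi)]
        have h3 : |(2 : ℝ) * ψ| < 2 := by rw [abs_mul, abs_two]; linarith
        nlinarith [Real.pi_gt_three, abs_nonneg (m : ℝ)]
    intro i j hij
    fin_cases i <;> fin_cases j
    all_goals first | exact absurd rfl hij | exact h01ψ.symm | exact h01ψ | exact h12ψ | exact h12ψ.symm | exact h02ψ | exact h02ψ.symm
  -- (d1): ONE compact `S ⊆ G_w ⧸ H_w` carrying the conjugates into `supp Θ′` of every `t_w z`, `z` on the curve, `|ψ| ≤ δ`; the Bruhat cut-off over `S`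
  have hKc : IsCompact ((fun ψ : ℝ => (fun i => z₀ i * Circle.exp ((![1, 0, -1] : Fin 3 → ℝ) i * ψ))) '' Metric.closedBall (0 : ℝ) δ) :=
    (isCompact_closedBall (0 : ℝ) δ).image (continuous_torusCurve z₀ ![(1 : ℝ), 0, -1])
  have hKsep : (fun ψ : ℝ => (fun i => z₀ i * Circle.exp ((![1, 0, -1] : Fin 3 → ℝ) i * ψ))) '' Metric.closedBall (0 : ℝ) δ ⊆ {z | z 1 ≠ z 0 ∧ z 1 ≠ z 2} := by
    rintro _ ⟨ψ, hψ, rfl⟩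
    have hψ' : |ψ| ≤ δ := by simpa [Real.dist_eq] using hψ
    exact hsep ψ (hδ₁' ψ hψ')
  obtain ⟨S, hS, hSmem⟩ := exists_isCompact_forall_mk_mem_of_conj_mem_wall L α w hα hherm h02 h01 hKc hKsep hΘ'k.isCompact
  obtain ⟨β, hβ, hβs, -, -, hβ1⟩ := exists_hasCompactSupport_integral_mul_fiber_eq_one (Subgroup.centralizer ({(⟨circleDiagonal 3 z₀, circleDiagonal_mem_archLocal_diagonal L 3 α w z₀⟩ : archLocal L 3 (Matrix.diagonal α) w)} : Set (archLocal L 3 (Matrix.diagonal α) w))) νH hZ hS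
  have h1 : ∀ ψ : ℝ, |ψ| ≤ δ → ∀ g : archLocal L 3 (Matrix.diagonal α) w, Θ' (((g * ⟨circleDiagonal 3 (fun i => z₀ i * Circle.exp ((![1, 0, -1] : Fin 3 → ℝ) i * ψ)), circleDiagonal_mem_archLocal_diagonal L 3 α w _⟩ * g⁻¹ : archLocal L 3 (Matrix.diagonal α) w) : GL (Fin 3) ℂ) : Matrix (Fin 3) (Fin 3) ℂ) ≠ 0 →
      ∫ h : Subgroup.centralizer ({(⟨circleDiagonal 3 z₀, circleDiagonal_mem_archLocal_diagonal L 3 α w z₀⟩ : archLocal L 3 (Matrix.diagonal α) w)} : Set (archLocal L 3 (Matrix.diagonal α) w)), β (g * h) ∂νH = 1 := fun ψ hψ g hg =>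
    hβ1 g (hSmem g _ ⟨ψ, by simpa [Real.dist_eq] using hψ, rfl⟩ (subset_tsupport (fun k : archLocal L 3 (Matrix.diagonal α) w => Θ' ((k : GL (Fin 3) ℂ) : Matrix (Fin 3) (Fin 3) ℂ)) hg))
  -- the averaged test function `f♭ ∈ C³_c` (★ p843990, ★ (d3a-II))
  have hf3 : ContDiff ℝ 3 (fun X : Matrix (Fin 2) (Fin 2) ℂ => ∫ g, (β g : ℂ) * Θ' (((g : GL (Fin 3) ℂ) : Matrix (Fin 3) (Fin 3) ℂ) * endoForm X ((circleDiagonal 1 ![z₀ 1] : GL (Fin 1) ℂ) : Matrix (Fin 1) (Fin 1) ℂ) * (((g : GL (Fin 3) ℂ)⁻¹ : GL (Fin 3) ℂ) : Matrix (Fin 3) (Fin 3) ℂ)) ∂ν) := contDiff_three_averagedTestFunction L α w ν β hβ hβs Θ' hΘ' _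
  have hfs : HasCompactSupport (fun X : Matrix (Fin 2) (Fin 2) ℂ => ∫ g, (β g : ℂ) * Θ' (((g : GL (Fin 3) ℂ) : Matrix (Fin 3) (Fin 3) ℂ) * endoForm X ((circleDiagonal 1 ![z₀ 1] : GL (Fin 1) ℂ) : Matrix (Fin 1) (Fin 1) ℂ) * (((g : GL (Fin 3) ℂ)⁻¹ : GL (Fin 3) ℂ) : Matrix (Fin 3) (Fin 3) ℂ)) ∂ν) := hasCompactSupport_averagedTestFunction L α w ν β hβs Θ' hΘ's _
  -- the torus elements along the curve, read in the blocks
  have hT : ∀ ψ : ℝ, (⟨circleDiagonal 2 ![(fun i => z₀ i * Circle.exp ((![1, 0, -1] : Fin 3 → ℝ) i * ψ)) 0, (fun i => z₀ i * Circle.exp ((![1, 0, -1] : Fin 3 → ℝ) i * ψ)) 2], (circleDiagonal_blocks_mem L α w (fun i => z₀ i * Circle.exp ((![1, 0, -1] : Fin 3 → ℝ) i * ψ))).1⟩ : unitaryGroupOfForm (starRingEnd ℂ) ((Matrix.diagonal ![α 0, α 2]).map w.1.embedding)) =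
      (⟨circleDiagonal 2 ![z₀ 0 * Circle.exp ψ, z₀ 0 * Circle.exp (-ψ)], circleDiagonal_mem_archLocal_diagonal L 2 ![α 0, α 2] w _⟩ : unitaryGroupOfForm (starRingEnd ℂ) ((Matrix.diagonal ![α 0, α 2]).map w.1.embedding)) := fun ψ => by
    apply Subtype.ext
    show circleDiagonal 2 _ = circleDiagonal 2 _
    congr 1
    funext i; fin_cases i
    · exact hz0 ψ
    · exact hz2 ψ
  have hD : ∀ ψ : ℝ, ((circleDiagonal 1 ![(fun i => z₀ i * Circle.exp ((![1, 0, -1] : Fin 3 → ℝ) i * ψ)) 1] : GL (Fin 1) ℂ) : Matrix (Fin 1) (Fin 1) ℂ) = ((circleDiagonal 1 ![z₀ 1] : GL (Fin 1) ℂ) : Matrix (Fin 1) (Fin 1) ℂ) := fun ψ => by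
    rw [hz1]
  -- THE IDENTITY on `0 < |ψ| < δ`: `2 sin ψ · Φ_Θ(z_ψ) = c₀ · F_{f♭}(ψ)`
  have hId : ∀ ψ : ℝ, ψ ≠ 0 → |ψ| < δ →
      (2 * Real.sin ψ : ℂ) * ∫ g, Θ' (((g * ⟨circleDiagonal 3 (fun i => z₀ i * Circle.exp ((![1, 0, -1] : Fin 3 → ℝ) i * ψ)), circleDiagonal_mem_archLocal_diagonal L 3 α w _⟩ * g⁻¹ : archLocal L 3 (Matrix.diagonal α) w) : GL (Fin 3) ℂ) : Matrix (Fin 3) (Fin 3) ℂ) ∂ν =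
      (c₀ : ℂ) * ((2 * Real.sin ψ) • ∫ h : unitaryGroupOfForm (starRingEnd ℂ) ((Matrix.diagonal ![α 0, α 2]).map w.1.embedding), (fun X : Matrix (Fin 2) (Fin 2) ℂ => ∫ g, (β g : ℂ) * Θ' (((g : GL (Fin 3) ℂ) : Matrix (Fin 3) (Fin 3) ℂ) * endoForm X ((circleDiagonal 1 ![z₀ 1] : GL (Fin 1) ℂ) : Matrix (Fin 1) (Fin 1) ℂ) * (((g : GL (Fin 3) ℂ)⁻¹ : GL (Fin 3) ℂ) : Matrix (Fin 3) (Fin 3) ℂ)) ∂ν)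
        (((h * (⟨circleDiagonal 2 ![z₀ 0 * Circle.exp ψ, z₀ 0 * Circle.exp (-ψ)], circleDiagonal_mem_archLocal_diagonal L 2 ![α 0, α 2] w _⟩ : unitaryGroupOfForm (starRingEnd ℂ) ((Matrix.diagonal ![α 0, α 2]).map w.1.embedding)) * h⁻¹ : unitaryGroupOfForm (starRingEnd ℂ) ((Matrix.diagonal ![α 0, α 2]).map w.1.embedding)) : GL (Fin 2) ℂ) : Matrix (Fin 2) (Fin 2) ℂ) ∂haar) := fun ψ hψ0 hψ => by
    rw [hB β hβ hβs _ (hreg ψ hψ0 hψ) Θ' hΘ'c hΘ'k (h1 ψ hψ.le)]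
    simp only [hT ψ, hD ψ, Complex.real_smul]
    push_cast
    ring
  -- ★ Z4: the jet package of `F_{f♭}` on `G₂`; ★ Z5 (a): the two-sided limit of `(m · F_{f♭})‴`
  obtain ⟨Ff, hFf⟩ : ∃ Ff : ℝ → ℂ, ∀ ψ : ℝ, Ff ψ = (2 * Real.sin ψ) • ∫ h : unitaryGroupOfForm (starRingEnd ℂ) ((Matrix.diagonal ![α 0, α 2]).map w.1.embedding), (fun X : Matrix (Fin 2) (Fin 2) ℂ => ∫ g, (β g : ℂ) * Θ' (((g : GL (Fin 3) ℂ) : Matrix (Fin 3) (Fin 3) ℂ) * endoForm X ((circleDiagonal 1 ![z₀ 1] : GL (Fin 1) ℂ) : Matrix (Fin 1) (Fin 1) ℂ) * (((g : GL (Fin 3) ℂ)⁻¹ : GL (Fin 3) ℂ) : Matrix (Fin 3) (Fin 3) ℂ)) ∂ν)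
        (((h * (⟨circleDiagonal 2 ![z₀ 0 * Circle.exp ψ, z₀ 0 * Circle.exp (-ψ)], circleDiagonal_mem_archLocal_diagonal L 2 ![α 0, α 2] w _⟩ : unitaryGroupOfForm (starRingEnd ℂ) ((Matrix.diagonal ![α 0, α 2]).map w.1.embedding)) * h⁻¹ : unitaryGroupOfForm (starRingEnd ℂ) ((Matrix.diagonal ![α 0, α 2]).map w.1.embedding)) : GL (Fin 2) ℂ) : Matrix (Fin 2) (Fin 2) ℂ) ∂haar := ⟨_, fun _ => rfl⟩
  obtain ⟨G, L₁, L₁', L₃, hF1, hG1, -, hjet⟩ := exists_jets_orbitalIntegral (E := ℂ) L ![α 0, α 2] w hα2 hreal2 hsgn2 (haar : Measure (unitaryGroupOfForm (starRingEnd ℂ) ((Matrix.diagonal ![α 0, α 2]).map w.1.embedding))) _ hf3 hfs (z₀ 0) hFf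
  obtain ⟨Lim, hLim⟩ := exists_tendsto_iteratedDeriv_three_evenFactor_mul (c₀ : ℂ) t hF1 hG1 hjet
  refine ⟨Lim, hLim.congr' ?_⟩
  -- `iteratedDeriv 3` is local: the two functions agree on `0 < |s| < δ`
  have hmem : Metric.ball (0 : ℝ) δ ∩ {(0 : ℝ)}ᶜ ∈ 𝓝[≠] (0 : ℝ) := inter_mem (mem_nhdsWithin_of_mem_nhds (Metric.ball_mem_nhds 0 hδ)) self_mem_nhdsWithin
  filter_upwards [hmem] with ψ hψ
  refine Filter.EventuallyEq.iteratedDeriv_eq 3 ?_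
  filter_upwards [(Metric.isOpen_ball.inter isOpen_compl_singleton).mem_nhds hψ] with s hs
  have hs0 : s ≠ 0 := hs.2
  have hsδ : |s| < δ := by simpa [Real.dist_eq] using (Metric.mem_ball.mp hs.1)
  rw [rhoWeylDelta_angleChart_wall02_line ζ t s, hcur s, hFf s]
  have key := hId s hs0 hsδ
  calc (c₀ : ℂ) * (Complex.I * (2 * Real.cos s - 2 * Real.cos (3 * t) : ℂ)) * ((2 * Real.sin s) • ∫ h : unitaryGroupOfForm (starRingEnd ℂ) ((Matrix.diagonal ![α 0, α 2]).map w.1.embedding), (fun X : Matrix (Fin 2) (Fin 2) ℂ => ∫ g, (β g : ℂ) * Θ' (((g : GL (Fin 3) ℂ) : Matrix (Fin 3) (Fin 3) ℂ) * endoForm X ((circleDiagonal 1 ![z₀ 1] : GL (Fin 1) ℂ) : Matrix (Fin 1) (Fin 1) ℂ) * (((g : GL (Fin 3) ℂ)⁻¹ : GL (Fin 3) ℂ) : Matrix (Fin 3) (Fin 3) ℂ)) ∂ν)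
        (((h * (⟨circleDiagonal 2 ![z₀ 0 * Circle.exp s, z₀ 0 * Circle.exp (-s)], circleDiagonal_mem_archLocal_diagonal L 2 ![α 0, α 2] w _⟩ : unitaryGroupOfForm (starRingEnd ℂ) ((Matrix.diagonal ![α 0, α 2]).map w.1.embedding)) * h⁻¹ : unitaryGroupOfForm (starRingEnd ℂ) ((Matrix.diagonal ![α 0, α 2]).map w.1.embedding)) : GL (Fin 2) ℂ) : Matrix (Fin 2) (Fin 2) ℂ) ∂haar)
      = (Complex.I * (2 * Real.cos s - 2 * Real.cos (3 * t) : ℂ)) * ((c₀ : ℂ) * ((2 * Real.sin s) • ∫ h : unitaryGroupOfForm (starRingEnd ℂ) ((Matrix.diagonal ![α 0, α 2]).map w.1.embedding), (fun X : Matrix (Fin 2) (Fin 2) ℂ => ∫ g, (β g : ℂ) * Θ' (((g : GL (Fin 3) ℂ) : Matrix (Fin 3) (Fin 3) ℂ) * endoForm X ((circleDiagonal 1 ![z₀ 1] : GL (Fin 1) ℂ) : Matrix (Fin 1) (Fin 1) ℂ) * (((g : GL (Fin 3) ℂ)⁻¹ : GL (Fin 3) ℂ) : Matrix (Fin 3)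 (Fin 3) ℂ)) ∂ν)
        (((h * (⟨circleDiagonal 2 ![z₀ 0 * Circle.exp s, z₀ 0 * Circle.exp (-s)], circleDiagonal_mem_archLocal_diagonal L 2 ![α 0, α 2] w _⟩ : unitaryGroupOfForm (starRingEnd ℂ) ((Matrix.diagonal ![α 0, α 2]).map w.1.embedding)) * h⁻¹ : unitaryGroupOfForm (starRingEnd ℂ) ((Matrix.diagonal ![α 0, α 2]).map w.1.embedding)) : GL (Fin 2) ℂ) : Matrix (Fin 2) (Fin 2) ℂ) ∂haar)) := by ring
    _ = (Complex.I * (2 * Real.cos s - 2 * Real.cos (3 * t) : ℂ)) * ((2 * Real.sin s : ℂ) * ∫ g, Θ' (((g * ⟨circleDiagonal 3 (fun i => z₀ i * Circle.exp ((![1, 0, -1] : Fin 3 → ℝ) i * s)), circleDiagonal_mem_archLocal_diagonal L 3 α w _⟩ * g⁻¹ : archLocal L 3 (Matrix.diagonal α) w) : GL (Fin 3) ℂ) : Matrix (Fin 3) (Fin 3) ℂ) ∂ν) := by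
        rw [← key]
    _ = (2 * Real.sin s : ℂ) * (Complex.I * (2 * Real.cos s - 2 * Real.cos (3 * t) : ℂ)) * ∫ g, Θ' (((g * ⟨circleDiagonal 3 (fun i => z₀ i * Circle.exp ((![1, 0, -1] : Fin 3 → ℝ) i * s)), circleDiagonal_mem_archLocal_diagonal L 3 α w _⟩ * g⁻¹ : archLocal L 3 (Matrix.diagonal α) w) : GL (Fin 3) ℂ) : Matrix (Fin 3) (Fin 3) ℂ) ∂ν := by
        ring

end CubeLimit

end Literature.NumberTheory.Rogawski1990

end
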